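import Literature.NumberTheory.LFunctions.ChebyshevHalfLineBiasThm3Proofs
import Literature.NumberTheory.LFunctions.MertensFirstVonMangoldtLower
import Mathlib.NumberTheory.Chebyshev
import Mathlib.Analysis.PSeries
import Mathlib.Algebra.Order.Field.GeomSum
import HarnessLib

/-!
# GRH(χ₄)-EQUIVALENT criterion (Suzuki 2025, Thm 4), PROVED — «nothing here bears on the truth of RH»
# `GRH for L(s, χ₄)` ⟺ `Σ_{2<p≤x} (−1)^{(p−1)/2} log p · √(x/p) log(x/p) → −∞`: discharge of `Suzuki2025Chebyshev_thm4`

LINE 1 — LABEL: RH-FREE literature (a kernel proof of a GRH(χ₄)-EQUIVALENCE; the new half, GRH ⟹ (1.18), is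
GRH(χ₄)-CONDITIONAL). bears_on: LADDER-RH COLUMN 1 SCREW (S-C, criterion rung). WHAT THIS IS NOT: not a route,
not progress toward RH or GRH — an equivalence fixes WHICH limit statement is the GRH for `L(s, χ₄)`; nothing here
bears on the truth of RH.

M. Suzuki, *On variants of Chebyshev's conjecture*, Ramanujan J. **68** (2025), no. 4, art. 95 = arXiv:2411.07436
[`Suzuki2025Chebyshev`; PUBLISHED, refereed], §1.2, **Theorem 4**, AS PRINTED: «The GRH for `L(s, χ₄)` holds if
and only if `lim_{x→∞} Σ_{2<p≤x} (−1)^{(p−1)/2} log p · √(x/p) log(x/p) = −∞` (1.18).» This is the named fact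
`Suzuki2025Chebyshev_thm4` of `ChebyshevHalfLineBiasVariants.lean` (RH literature-typing tranche 1, p461476),
DISCHARGED here: `Suzuki2025Chebyshev_thm4_holds`. The «if» half is the tree's `Suzuki2025Chebyshev_thm4_mpr`
(`ChebyshevHalfLineBiasChi4Proofs.lean`: Thm 9, first half, Landau); the «only if» half is
`SuzukiChi4Thm4.Suzuki2025Chebyshev_thm4_mp` below. Theorems only: no definitions, no named facts (D-0014/D-0026).

## The printed proof (§4.2, Thm 9 at `χ = χ₄`) and this formalisation

With `f_χ(x) = Σ_{n≤x} Λ(n)χ(n) n^{-1/2} log(x/n) = f₁ + f₂ + f₃` (primes, prime squares, higher powers):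
«suppose that the GRH for `L(s)` holds. Then, `f_χ(x) = O(log x)` by (4.5). On the other hand,
`f_χ(x) = f₁(x) + ¼(log x)² + O(log x)` by (4.9) and (4.10). Combining these two,
`f₁(x) = −¼(log x)²(1 + O(1/log x))`», and the sum (1.18) is `√x · f₁(x) → −∞`. Here:

* the decomposition `Σ_{n ≤ x} Λ(n)a(n) = Σ_{k ≥ 1} Σ_{p ≤ x^{1/k}} log p · a(p^k)` is Mathlib's
  `Chebyshev.sum_PrimePow_eq_sum_sum'`; `(1.18) = √x · f₁(x)` is `primeSum_eq_sqrt_mul` (`χ₄(2) = 0`,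
  `χ₄(p) = (−1)^{(p−1)/2}` for odd `p`);
* **(4.5) under GRH** is the tree's `HalfLineRiesz.exists_norm_halfLineSum_add_le_of_GRH`
  (`ChebyshevHalfLineBiasCharExplicitFormula.lean`) with `χ₄` primitive and `L(½, χ₄) ≠ 0`
  (`ChebyshevHalfLineBiasThm3Proofs.lean`), in the real form `f_{χ₄}(x) ≤ −(L'/L)(½, χ₄) log x + B`
  (`realSum_le_of_GRH`; the sign `(L'/L)(½, χ₄) > 0` of `SuzukiChi4Riesz.re_logDeriv_LFunction_χ4_half_pos` is
  not even needed here, only that it is a constant);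
* **(4.9), lower half**: `f₂(x) = Σ_{p ≤ √x} χ₄(p)² (log p/p) log(x/p²) ≥ ½ log x · Σ_{p ≤ x^{1/4}} χ₄(p)² log p/p
  ≥ ½ log x (¼ log x − C₁)` (`sq_block_ge`), from **Mertens' first theorem, lower half, over the odd primes**
  (`exists_sum_log_div_prime_ge`: the tree's `|Σ_{n ≤ y} Λ(n)/n − log y| ≤ 1 + log 2`,
  `MertensFirstVonMangoldtLower.lean`, Hardy–Wright Thm 424, minus the prime powers `k ≥ 2`, which are bounded by
  `exists_sum_sum_primePow_le`, and minus the prime `2`). The printed two-sided `f₂ = ¼ log² x + O(log x)` is not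
  needed for `−∞`;
* **(4.10), lower half**: `f₃ ≥ −C₃ log x` (`higher_block_ge`: `|χ₄| ≤ 1`, `0 ≤ log(x/p^k) ≤ log x`, and
  `Σ_k≥3 Σ_p log p · p^{−k/2} < ∞` by a geometric series in `k` and `Σ_n log n · n^{−3/2} < ∞`,
  `exists_sum_sum_primePow_le` / `summable_log_mul_rpow_neg`);
* hence `f₁(x) ≤ −⅛ log² x + α log x + B → −∞`, and `(1.18) = √x f₁(x) ≤ f₁(x)` once `f₁ < 0` (`quad_le`).

## References
* [Suzuki2025Chebyshev] M. Suzuki, Ramanujan J. 68 (2025) 95 = arXiv:2411.07436: §1.2 Thm 4, (1.18); §4.2 Thm 9,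
  (4.8)–(4.11); §2.1 (2.1) (Mertens).
* [HardyWright2008] G. H. Hardy, E. M. Wright, *An Introduction to the Theory of Numbers*, Thms 424–425 — the tree's
  `MertensFirstVonMangoldtLower.lean` / `MertensElementary.lean`.
-/


noncomputable section

open Real Filter Topology ArithmeticFunction Finset
open scoped Chebyshev

namespace Literature.NumberTheory.LFunctions

namespace SuzukiChi4Thm4

/-! ## §1 Two elementary summation lemmas: `Σ_n log n · n^{-a} < ∞` and the higher prime powers -/

/-- `Σ_n log n · n^{−a}` converges for `a > 1` (`log n ≤ n^ε/ε`). [folklore] -/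
private theorem summable_log_mul_rpow_neg {a : ℝ} (ha : 1 < a) :
    Summable fun n : ℕ ↦ Real.log n * (n : ℝ) ^ (-a) := by
  set ε : ℝ := (a - 1) / 2 with hε
  have hε0 : 0 < ε := by rw [hε]; linarith
  have hsum : Summable fun n : ℕ ↦ (1 / ε) * (n : ℝ) ^ (ε - a) := by
    refine (Real.summable_nat_rpow.2 ?_).mul_left _
    rw [hε]; linarith
  refine Summable.of_nonneg_of_le (fun n ↦ ?_) (fun n ↦ ?_) hsum
  · exact mul_nonneg (Real.log_natCast_nonneg n) (Real.rpow_nonneg (Nat.cast_nonneg n) _)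
  · have hn : (0 : ℝ) ≤ n := Nat.cast_nonneg n
    have h1 : Real.log n ≤ (n : ℝ) ^ ε / ε := Real.log_le_rpow_div hn hε0
    calc Real.log n * (n : ℝ) ^ (-a) ≤ (n : ℝ) ^ ε / ε * (n : ℝ) ^ (-a) :=
          mul_le_mul_of_nonneg_right h1 (Real.rpow_nonneg hn _)
      _ = 1 / ε * ((n : ℝ) ^ ε * (n : ℝ) ^ (-a)) := by ring
      _ = 1 / ε * (n : ℝ) ^ (ε - a) := by
          rcases eq_or_lt_of_le hn with h0 | hpos
          · rw [← h0]
            rw [Real.zero_rpow hε0.ne', zero_mul, Real.zero_rpow (by linarith)]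
          · rw [← Real.rpow_add hpos]; ring_nf

/-- **The higher prime powers are summable against `log p · p^{−ks}` when `k₀ s > 1`**: there is `C` with
`Σ_{k₀ ≤ k ≤ K} Σ_{p ≤ x^{1/k}} log p · p^{−ks} ≤ C` for all `x ≥ 1` and all `K` (geometric series in `k`,
`p^{−s} ≤ 2^{−s} < 1`, then `Σ_p log p · p^{−k₀ s} < ∞`). [folklore] -/
private theorem exists_sum_sum_primePow_le {s : ℝ} {k₀ : ℕ} (hs : 0 < s) (hk : 1 < (k₀ : ℝ) * s) :
    ∃ C : ℝ, ∀ (x : ℝ) (K : ℕ), 1 ≤ x →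
      ∑ k ∈ Icc k₀ K, ∑ p ∈ (Ioc 0 ⌊x ^ ((1 : ℝ) / k)⌋₊).filter Nat.Prime,
          Real.log p * (p : ℝ) ^ (-(s * k)) ≤ C := by
  have hr1 : (2 : ℝ) ^ (-s) < 1 := Real.rpow_lt_one_of_one_lt_of_neg (by norm_num) (by linarith)
  have hr0 : 0 < 1 - (2 : ℝ) ^ (-s) := by linarith
  have hsum := summable_log_mul_rpow_neg hk
  set S : ℝ := ∑' n : ℕ, Real.log n * (n : ℝ) ^ (-((k₀ : ℝ) * s)) with hS
  refine ⟨S / (1 - (2 : ℝ) ^ (-s)), fun x K hx ↦ ?_⟩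
  -- enlarge every inner index set to the primes `≤ x`
  set T := (Ioc 0 ⌊x⌋₊).filter Nat.Prime with hT
  have hsub : ∀ k ∈ Icc k₀ K, (Ioc 0 ⌊x ^ ((1 : ℝ) / k)⌋₊).filter Nat.Prime ⊆ T := by
    intro k hk
    refine Finset.filter_subset_filter _ (Finset.Ioc_subset_Ioc_right (Nat.floor_le_floor ?_))
    rcases Nat.eq_zero_or_pos k with h0 | hpos
    · subst h0; simpa using hx
    · refine Real.rpow_le_self_of_one_le hx ?_
      rw [div_le_one (by exact_mod_cast hpos)]
      exact_mod_cast hpos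
  have hnn : ∀ (k : ℕ) (p : ℕ), 0 ≤ Real.log p * (p : ℝ) ^ (-(s * k)) := fun k p ↦
    mul_nonneg (Real.log_natCast_nonneg p) (Real.rpow_nonneg (Nat.cast_nonneg p) _)
  calc ∑ k ∈ Icc k₀ K, ∑ p ∈ (Ioc 0 ⌊x ^ ((1 : ℝ) / k)⌋₊).filter Nat.Prime, Real.log p * (p : ℝ) ^ (-(s * k))
      ≤ ∑ k ∈ Icc k₀ K, ∑ p ∈ T, Real.log p * (p : ℝ) ^ (-(s * k)) :=
        Finset.sum_le_sum fun k hk ↦ Finset.sum_le_sum_of_subset_of_nonneg (hsub k hk) fun p _ _ ↦ hnn k p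
    _ = ∑ p ∈ T, Real.log p * ∑ k ∈ Icc k₀ K, (p : ℝ) ^ (-(s * k)) := by
        rw [Finset.sum_comm]
        refine Finset.sum_congr rfl fun p _ ↦ ?_
        rw [Finset.mul_sum]
    _ ≤ ∑ p ∈ T, Real.log p * ((p : ℝ) ^ (-((k₀ : ℝ) * s)) / (1 - (2 : ℝ) ^ (-s))) := by
        refine Finset.sum_le_sum fun p hp ↦ mul_le_mul_of_nonneg_left ?_ (Real.log_natCast_nonneg p)
        rw [hT, Finset.mem_filter] at hp
        have hp2 : (2 : ℝ) ≤ p := by exact_mod_cast hp.2.two_le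
        have hp0 : (0 : ℝ) < p := by linarith
        -- `p^{-sk} = r^k`, `r = p^{-s} ≤ 2^{-s}`
        set r : ℝ := (p : ℝ) ^ (-s) with hr
        have hr_nn : 0 ≤ r := Real.rpow_nonneg hp0.le _
        have hr_le : r ≤ (2 : ℝ) ^ (-s) := Real.rpow_le_rpow_of_nonpos (by norm_num) hp2 (by linarith)
        have hr_lt : r < 1 := hr_le.trans_lt hr1
        have hterm : ∀ k : ℕ, (p : ℝ) ^ (-(s * k)) = r ^ k := by
          intro k
          rw [hr, ← Real.rpow_natCast, ← Real.rpow_mul hp0.le]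
          ring_nf
        have hk₀ : (p : ℝ) ^ (-((k₀ : ℝ) * s)) = r ^ k₀ := by
          rw [hr, ← Real.rpow_natCast, ← Real.rpow_mul hp0.le]
          ring_nf
        simp_rw [hterm]
        rw [hk₀, show Icc k₀ K = Ico k₀ (K + 1) from rfl]
        calc ∑ k ∈ Ico k₀ (K + 1), r ^ k ≤ r ^ k₀ / (1 - r) := geom_sum_Ico_le_of_lt_one hr_nn hr_lt
          _ ≤ r ^ k₀ / (1 - (2 : ℝ) ^ (-s)) := by
              refine div_le_div_of_nonneg_left (pow_nonneg hr_nn _) hr0 ?_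
              linarith
    _ = (∑ p ∈ T, Real.log p * (p : ℝ) ^ (-((k₀ : ℝ) * s))) / (1 - (2 : ℝ) ^ (-s)) := by
        rw [Finset.sum_div]
        refine Finset.sum_congr rfl fun p _ ↦ ?_
        ring
    _ ≤ S / (1 - (2 : ℝ) ^ (-s)) := by
        refine div_le_div_of_nonneg_right ?_ hr0.le
        rw [hS]
        refine Summable.sum_le_tsum T (fun n _ ↦ ?_) hsum
        exact mul_nonneg (Real.log_natCast_nonneg n) (Real.rpow_nonneg (Nat.cast_nonneg n) _)


/-! ## §2 Prime-power bookkeeping: `Σ_{n ≤ x} Λ(n) a(n) = Σ_k Σ_{p ≤ x^{1/k}} log p · a(p^k)` -/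

/-- `Σ_{n ∈ Icc 1 ⌊x⌋} Λ(n) a(n) = Σ_{k ∈ Icc 1 N} Σ_{p ≤ x^{1/k} prime} log p · a(p^k)` for any
`N ≥ ⌊log x/log 2⌋` (Mathlib's `Chebyshev.sum_PrimePow_eq_sum_sum'`; `Λ` vanishes off prime powers).
[folklore] -/
private theorem sum_vonMangoldt_mul_eq_sum_sum (a : ℕ → ℝ) {x : ℝ} (hx : 0 ≤ x) {N : ℕ}
    (hN : ⌊Real.log x / Real.log 2⌋₊ ≤ N) :
    ∑ n ∈ Icc 1 ⌊x⌋₊, Λ n * a n =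
      ∑ k ∈ Icc 1 N, ∑ p ∈ (Ioc 0 ⌊x ^ ((1 : ℝ) / k)⌋₊).filter Nat.Prime, Real.log p * a (p ^ k) := by
  have hIcc : Icc 1 ⌊x⌋₊ = Ioc 0 ⌊x⌋₊ := rfl
  rw [hIcc]
  have h1 : ∑ n ∈ Ioc 0 ⌊x⌋₊, Λ n * a n = ∑ n ∈ (Ioc 0 ⌊x⌋₊).filter IsPrimePow, Λ n * a n := by
    rw [Finset.sum_filter]
    refine Finset.sum_congr rfl fun n _ ↦ ?_
    split_ifs with h
    · rfl
    · rw [ArithmeticFunction.vonMangoldt_eq_zero_iff.2 h, zero_mul]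
  rw [h1, Chebyshev.sum_PrimePow_eq_sum_sum' (fun n ↦ Λ n * a n) hx hN]
  refine Finset.sum_congr rfl fun k hk ↦ Finset.sum_congr rfl fun p hp ↦ ?_
  rw [Finset.mem_Icc] at hk
  rw [Finset.mem_filter] at hp
  rw [ArithmeticFunction.vonMangoldt_apply_pow (by omega), ArithmeticFunction.vonMangoldt_apply_prime hp.2]

/-- Membership in the `k`-th prime block: `p` prime and `p^k ≤ x` (`x ≥ 0`, `k ≥ 1`). [folklore] -/
private theorem pow_le_of_mem {x : ℝ} (hx : 0 ≤ x) {k p : ℕ} (hk : 1 ≤ k)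
    (hp : p ∈ (Ioc 0 ⌊x ^ ((1 : ℝ) / k)⌋₊).filter Nat.Prime) : p.Prime ∧ ((p : ℝ) ^ k ≤ x) := by
  rw [Finset.mem_filter, Finset.mem_Ioc] at hp
  refine ⟨hp.2, ?_⟩
  have h1 : (p : ℝ) ≤ x ^ ((1 : ℝ) / k) := le_trans (by exact_mod_cast hp.1.2) (Nat.floor_le (by positivity))
  have hk0 : (0 : ℝ) < k := by exact_mod_cast hk
  have h2 : (p : ℝ) ^ (k : ℝ) ≤ (x ^ ((1 : ℝ) / k)) ^ (k : ℝ) :=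
    Real.rpow_le_rpow (Nat.cast_nonneg p) h1 hk0.le
  rw [← Real.rpow_mul hx, one_div, inv_mul_cancel₀ hk0.ne', Real.rpow_one, Real.rpow_natCast] at h2
  exact h2

/-! ## §3 Mertens' first theorem, lower half, for `Σ_{p ≤ y} χ₄(p)² log p/p` -/

/-- `χ₄(n)` as a real number has absolute value `≤ 1`. [folklore] -/
private theorem abs_χ4_le_one (n : ℕ) : |(ZMod.χ₄ (n : ZMod 4) : ℝ)| ≤ 1 := by
  rw [ZMod.χ₄_nat_eq_if_mod_four]
  split_ifs <;> simp

/-- `χ₄(p)² = 1` for an odd prime (indeed for odd `p`). [folklore] -/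
private theorem χ4_sq_eq_one {p : ℕ} (hp : p % 2 = 1) : (ZMod.χ₄ (p : ZMod 4) : ℝ) ^ 2 = 1 := by
  rw [ZMod.χ₄_eq_neg_one_pow hp]
  push_cast
  rw [← pow_mul, mul_comm, pow_mul]
  simp

/-- **Mertens I, lower half, over odd primes**: there is `C₁` with
`Σ_{p ≤ y} χ₄(p)² log p/p ≥ log y − C₁` for all `y ≥ 1` (the tree's `|Σ_{n ≤ y} Λ(n)/n − log y| ≤ 1 + log 2`,
Hardy–Wright Thm 424, minus the prime powers `k ≥ 2` and the prime `2`). [cite: HardyWright2008, Theorem 424–425] -/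
theorem exists_sum_log_div_prime_ge :
    ∃ C₁ : ℝ, ∀ y : ℝ, 1 ≤ y →
      Real.log y - C₁ ≤ ∑ p ∈ (Ioc 0 ⌊y⌋₊).filter Nat.Prime,
        (ZMod.χ₄ (p : ZMod 4) : ℝ) ^ 2 * Real.log p / p := by
  obtain ⟨C₂, hC₂⟩ := exists_sum_sum_primePow_le (s := 1) (k₀ := 2) one_pos (by norm_num)
  refine ⟨1 + Real.log 2 + C₂ + Real.log 2 / 2, fun y hy ↦ ?_⟩
  have hy0 : 0 ≤ y := by linarith
  -- Mertens for `Λ(n)/n`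
  have hM := MertensFirstLower.log_sub_le_sum_vonMangoldt_div_floor hy
  -- reindex by prime powers with `N = max ⌊log y/log 2⌋ 2`
  set N : ℕ := max ⌊Real.log y / Real.log 2⌋₊ 2 with hN
  have hN1 : ⌊Real.log y / Real.log 2⌋₊ ≤ N := le_max_left _ _
  have hN2 : 2 ≤ N := le_max_right _ _
  have hdec : ∑ n ∈ Ioc 0 ⌊y⌋₊, Λ n / n =
      ∑ k ∈ Icc 1 N, ∑ p ∈ (Ioc 0 ⌊y ^ ((1 : ℝ) / k)⌋₊).filter Nat.Prime, Real.log p * ((p : ℝ) ^ k)⁻¹ := by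
    have h := sum_vonMangoldt_mul_eq_sum_sum (fun n ↦ ((n : ℝ))⁻¹) hy0 hN1
    simp only [div_eq_mul_inv] at h ⊢
    rw [show Icc 1 ⌊y⌋₊ = Ioc 0 ⌊y⌋₊ from rfl] at h
    rw [h]
    simp
  -- split `k = 1` from `k ≥ 2`
  have hsplit : Icc 1 N = insert 1 (Ioc 1 N) := (Finset.Ioc_insert_left (by omega)).symm
  have hIoc : Ioc 1 N = Icc 2 N := rfl
  have hnot : 1 ∉ Icc 2 N := by simp
  rw [hIoc] at hsplit
  rw [hdec, hsplit, Finset.sum_insert hnot] at hM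
  -- the `k = 1` block is `Σ_{p ≤ y} log p / p`
  have hy1 : y ^ ((1 : ℝ) / (1 : ℕ)) = y := by simp
  rw [hy1] at hM
  -- the `k ≥ 2` blocks are `≤ C₂`
  have htail : ∑ k ∈ Icc 2 N, ∑ p ∈ (Ioc 0 ⌊y ^ ((1 : ℝ) / k)⌋₊).filter Nat.Prime,
      Real.log p * ((p : ℝ) ^ k)⁻¹ ≤ C₂ := by
    have h := hC₂ y N hy
    refine le_trans (le_of_eq ?_) h
    refine Finset.sum_congr rfl fun k _ ↦ Finset.sum_congr rfl fun p hp ↦ ?_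
    rw [Finset.mem_filter] at hp
    have hp0 : (0 : ℝ) ≤ p := Nat.cast_nonneg p
    rw [← Real.rpow_natCast, ← Real.rpow_neg hp0]
    ring_nf
  -- the prime `2`
  have h2 : ∑ p ∈ (Ioc 0 ⌊y⌋₊).filter Nat.Prime, Real.log p * ((p : ℝ) ^ 1)⁻¹ ≤
      ∑ p ∈ (Ioc 0 ⌊y⌋₊).filter Nat.Prime, (ZMod.χ₄ (p : ZMod 4) : ℝ) ^ 2 * Real.log p / p
        + Real.log 2 / 2 := by
    have hle : ∀ p ∈ (Ioc 0 ⌊y⌋₊).filter Nat.Prime, Real.log p * ((p : ℝ) ^ 1)⁻¹ ≤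
        (ZMod.χ₄ (p : ZMod 4) : ℝ) ^ 2 * Real.log p / p + if p = 2 then Real.log 2 / 2 else 0 := by
      intro p hp
      rw [Finset.mem_filter] at hp
      rcases hp.2.eq_two_or_odd' with rfl | hodd
      · have h0 : ZMod.χ₄ ((2 : ℕ) : ZMod 4) = 0 := by decide
        rw [h0, if_pos rfl]
        push_cast
        apply le_of_eq
        ring
      · rw [χ4_sq_eq_one (Nat.odd_iff.1 hodd)]
        split_ifs
        · simp [div_eq_mul_inv]; positivity
        · simp [div_eq_mul_inv]
    refine (Finset.sum_le_sum hle).trans ?_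
    rw [Finset.sum_add_distrib, Finset.sum_ite_eq']
    split_ifs
    · exact le_rfl
    · simp; positivity
  linarith

/-! ## §4 The three blocks of `f_{χ₄}`: primes, prime squares, higher powers -/

/-- **The prime squares** (`f₂` of the paper, lower half of (4.9)): for `x ≥ 1`,
`Σ_{p ≤ √x} log p · χ₄(p²) (p²)^{-1/2} log(x/p²) ≥ ½ log x · (¼ log x − C₁)` — every term is `≥ 0`, and for
`p ≤ x^{1/4}` the weight `log(x/p²)` is `≥ ½ log x` (Mertens I, lower half, for the odd primes).
[cite: Suzuki2025Chebyshev, §4.2 (4.9)] -/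
theorem sq_block_ge : ∃ C₁ : ℝ, ∀ x : ℝ, 1 ≤ x →
    1 / 2 * Real.log x * (1 / 4 * Real.log x - C₁) ≤
      ∑ p ∈ (Ioc 0 ⌊x ^ ((1 : ℝ) / (2 : ℕ))⌋₊).filter Nat.Prime,
        Real.log p * ((ZMod.χ₄ ((p ^ 2 : ℕ) : ZMod 4) : ℝ) / Real.sqrt ((p ^ 2 : ℕ) : ℝ) *
          Real.log (x / ((p ^ 2 : ℕ) : ℝ))) := by
  obtain ⟨C₁, hC₁⟩ := exists_sum_log_div_prime_ge
  refine ⟨C₁, fun x hx ↦ ?_⟩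
  have hx0 : 0 ≤ x := by linarith
  have hlx : 0 ≤ Real.log x := Real.log_nonneg hx
  -- the summand, simplified: `log p · χ₄(p)²/p · log(x/p²)`
  have hterm : ∀ p : ℕ, p.Prime →
      Real.log p * ((ZMod.χ₄ ((p ^ 2 : ℕ) : ZMod 4) : ℝ) / Real.sqrt ((p ^ 2 : ℕ) : ℝ) *
        Real.log (x / ((p ^ 2 : ℕ) : ℝ))) =
      (ZMod.χ₄ (p : ZMod 4) : ℝ) ^ 2 * Real.log p / p * (Real.log x - 2 * Real.log p) := by
    intro p hp
    have hp0 : (0 : ℝ) < p := by exact_mod_cast hp.pos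
    rw [Nat.cast_pow, map_pow, Int.cast_pow, Nat.cast_pow, Real.sqrt_sq hp0.le,
      Real.log_div (by linarith) (by positivity), Real.log_pow]
    push_cast
    ring
  -- restrict to `p ≤ x^{1/4}`
  set P₂ := (Ioc 0 ⌊x ^ ((1 : ℝ) / (2 : ℕ))⌋₊).filter Nat.Prime with hP₂
  set P₄ := (Ioc 0 ⌊x ^ ((1 : ℝ) / (4 : ℕ))⌋₊).filter Nat.Prime with hP₄
  have hsub : P₄ ⊆ P₂ := by
    refine Finset.filter_subset_filter _ (Finset.Ioc_subset_Ioc_right (Nat.floor_le_floor ?_))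
    exact Real.rpow_le_rpow_of_exponent_le hx (by norm_num)
  have hnn : ∀ p ∈ P₂, 0 ≤ Real.log p * ((ZMod.χ₄ ((p ^ 2 : ℕ) : ZMod 4) : ℝ) / Real.sqrt ((p ^ 2 : ℕ) : ℝ) *
      Real.log (x / ((p ^ 2 : ℕ) : ℝ))) := by
    intro p hp
    obtain ⟨hpr, hpx⟩ := pow_le_of_mem hx0 (by norm_num) hp
    rw [hterm p hpr]
    have hp1 : (1 : ℝ) ≤ p := by exact_mod_cast hpr.one_le
    have hlogp : 2 * Real.log p ≤ Real.log x := by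
      have h := Real.log_le_log (by positivity) hpx
      rw [Real.log_pow] at h
      push_cast at h
      linarith
    have : 0 ≤ Real.log x - 2 * Real.log p := by linarith
    have : 0 ≤ Real.log (p : ℝ) := Real.log_nonneg hp1
    positivity
  have hP₄le : ∀ p ∈ P₄, 1 / 2 * Real.log x * ((ZMod.χ₄ (p : ZMod 4) : ℝ) ^ 2 * Real.log p / p) ≤
      Real.log p * ((ZMod.χ₄ ((p ^ 2 : ℕ) : ZMod 4) : ℝ) / Real.sqrt ((p ^ 2 : ℕ) : ℝ) *
        Real.log (x / ((p ^ 2 : ℕ) : ℝ))) := by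
    intro p hp
    obtain ⟨hpr, hpx⟩ := pow_le_of_mem hx0 (by norm_num) hp
    rw [hterm p hpr]
    have hp1 : (1 : ℝ) ≤ p := by exact_mod_cast hpr.one_le
    have hlogp : 4 * Real.log p ≤ Real.log x := by
      have h := Real.log_le_log (by positivity) hpx
      rw [Real.log_pow] at h
      push_cast at h
      linarith
    have h1 : 1 / 2 * Real.log x ≤ Real.log x - 2 * Real.log p := by linarith
    have h2 : 0 ≤ (ZMod.χ₄ (p : ZMod 4) : ℝ) ^ 2 * Real.log p / p := by
      have : 0 ≤ Real.log (p : ℝ) := Real.log_nonneg hp1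
      positivity
    calc 1 / 2 * Real.log x * ((ZMod.χ₄ (p : ZMod 4) : ℝ) ^ 2 * Real.log p / p)
        = (ZMod.χ₄ (p : ZMod 4) : ℝ) ^ 2 * Real.log p / p * (1 / 2 * Real.log x) := by ring
      _ ≤ (ZMod.χ₄ (p : ZMod 4) : ℝ) ^ 2 * Real.log p / p * (Real.log x - 2 * Real.log p) :=
          mul_le_mul_of_nonneg_left h1 h2
  have hx4 : (1 : ℝ) ≤ x ^ ((1 : ℝ) / (4 : ℕ)) := Real.one_le_rpow hx (by norm_num)
  have hMer := hC₁ _ hx4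
  rw [Real.log_rpow (by linarith),
    show (1 : ℝ) / ((4 : ℕ) : ℝ) * Real.log x = 1 / 4 * Real.log x by norm_num] at hMer
  calc 1 / 2 * Real.log x * (1 / 4 * Real.log x - C₁)
      ≤ 1 / 2 * Real.log x * ∑ p ∈ P₄, (ZMod.χ₄ (p : ZMod 4) : ℝ) ^ 2 * Real.log p / p := by
        refine mul_le_mul_of_nonneg_left ?_ (by positivity)
        rw [hP₄]
        linarith
    _ = ∑ p ∈ P₄, 1 / 2 * Real.log x * ((ZMod.χ₄ (p : ZMod 4) : ℝ) ^ 2 * Real.log p / p) := by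
        rw [Finset.mul_sum]
    _ ≤ ∑ p ∈ P₄, Real.log p * ((ZMod.χ₄ ((p ^ 2 : ℕ) : ZMod 4) : ℝ) / Real.sqrt ((p ^ 2 : ℕ) : ℝ) *
        Real.log (x / ((p ^ 2 : ℕ) : ℝ))) := Finset.sum_le_sum hP₄le
    _ ≤ ∑ p ∈ P₂, Real.log p * ((ZMod.χ₄ ((p ^ 2 : ℕ) : ZMod 4) : ℝ) / Real.sqrt ((p ^ 2 : ℕ) : ℝ) *
        Real.log (x / ((p ^ 2 : ℕ) : ℝ))) :=
        Finset.sum_le_sum_of_subset_of_nonneg hsub fun p hp _ ↦ hnn p hp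

/-- **The higher prime powers** (`f₃` of the paper, (4.10)): there is `C₃` with
`Σ_{3 ≤ k ≤ N} Σ_{p ≤ x^{1/k}} log p · χ₄(p^k)(p^k)^{-1/2} log(x/p^k) ≥ −C₃ log x` for all `x ≥ 1`, `N`
(`|χ₄| ≤ 1`, `0 ≤ log(x/p^k) ≤ log x`, and `Σ_p Σ_{k ≥ 3} log p · p^{−k/2} < ∞`). [cite: Suzuki2025Chebyshev, §4.2 (4.10)] -/
theorem higher_block_ge : ∃ C₃ : ℝ, ∀ (x : ℝ) (N : ℕ), 1 ≤ x →
    -(C₃ * Real.log x) ≤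
      ∑ k ∈ Icc 3 N, ∑ p ∈ (Ioc 0 ⌊x ^ ((1 : ℝ) / k)⌋₊).filter Nat.Prime,
        Real.log p * ((ZMod.χ₄ ((p ^ k : ℕ) : ZMod 4) : ℝ) / Real.sqrt ((p ^ k : ℕ) : ℝ) *
          Real.log (x / ((p ^ k : ℕ) : ℝ))) := by
  obtain ⟨C₃, hC₃⟩ := exists_sum_sum_primePow_le (s := 1 / 2) (k₀ := 3) (by norm_num) (by norm_num)
  refine ⟨C₃, fun x N hx ↦ ?_⟩
  have hx0 : 0 ≤ x := by linarith
  have hlx : 0 ≤ Real.log x := Real.log_nonneg hx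
  have hbound := hC₃ x N hx
  -- termwise: `term ≥ −log x · (log p · p^{-k/2})`
  have hterm : ∀ k ∈ Icc 3 N, ∀ p ∈ (Ioc 0 ⌊x ^ ((1 : ℝ) / k)⌋₊).filter Nat.Prime,
      -(Real.log x * (Real.log p * (p : ℝ) ^ (-(1 / 2 * (k : ℝ))))) ≤
        Real.log p * ((ZMod.χ₄ ((p ^ k : ℕ) : ZMod 4) : ℝ) / Real.sqrt ((p ^ k : ℕ) : ℝ) *
          Real.log (x / ((p ^ k : ℕ) : ℝ))) := by
    intro k hk p hp
    rw [Finset.mem_Icc] at hk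
    obtain ⟨hpr, hpx⟩ := pow_le_of_mem hx0 (by omega) hp
    have hp0 : (0 : ℝ) < p := by exact_mod_cast hpr.pos
    have hpk1 : (1 : ℝ) ≤ (p : ℝ) ^ k := one_le_pow₀ (by exact_mod_cast hpr.one_le)
    have hsqrt : Real.sqrt ((p ^ k : ℕ) : ℝ) = (p : ℝ) ^ (1 / 2 * (k : ℝ)) := by
      rw [Nat.cast_pow, Real.sqrt_eq_rpow, ← Real.rpow_natCast, ← Real.rpow_mul hp0.le]
      ring_nf
    have hsqrt_pos : 0 < (p : ℝ) ^ (1 / 2 * (k : ℝ)) := Real.rpow_pos_of_pos hp0 _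
    have hlog0 : 0 ≤ Real.log (x / ((p ^ k : ℕ) : ℝ)) := by
      rw [Nat.cast_pow]
      exact Real.log_nonneg ((one_le_div (by positivity)).2 hpx)
    have hlogle : Real.log (x / ((p ^ k : ℕ) : ℝ)) ≤ Real.log x := by
      rw [Nat.cast_pow]
      refine Real.log_le_log (by positivity) ?_
      exact div_le_self hx0 hpk1
    have hchi : |(ZMod.χ₄ ((p ^ k : ℕ) : ZMod 4) : ℝ)| ≤ 1 := abs_χ4_le_one _
    rw [hsqrt, Real.rpow_neg hp0.le]
    have hlogp : 0 ≤ Real.log (p : ℝ) := Real.log_nonneg (by exact_mod_cast hpr.one_le)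
    -- `|log p · χ / p^{k/2} · log(x/p^k)| ≤ log p · p^{-k/2} · log x`
    have habs : |Real.log p * ((ZMod.χ₄ ((p ^ k : ℕ) : ZMod 4) : ℝ) / (p : ℝ) ^ (1 / 2 * (k : ℝ)) *
        Real.log (x / ((p ^ k : ℕ) : ℝ)))| ≤ Real.log x * (Real.log p * ((p : ℝ) ^ (1 / 2 * (k : ℝ)))⁻¹) := by
      rw [abs_mul, abs_mul, abs_div, abs_of_nonneg hlogp, abs_of_nonneg hlog0, abs_of_pos hsqrt_pos]
      calc Real.log p * (|(ZMod.χ₄ ((p ^ k : ℕ) : ZMod 4) : ℝ)| / (p : ℝ) ^ (1 / 2 * (k : ℝ)) *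
            Real.log (x / ((p ^ k : ℕ) : ℝ)))
          ≤ Real.log p * (1 / (p : ℝ) ^ (1 / 2 * (k : ℝ)) * Real.log x) := by
            gcongr
        _ = Real.log x * (Real.log p * ((p : ℝ) ^ (1 / 2 * (k : ℝ)))⁻¹) := by ring
    exact (neg_le_of_abs_le habs)
  calc -(C₃ * Real.log x) ≤ -(Real.log x * ∑ k ∈ Icc 3 N, ∑ p ∈ (Ioc 0 ⌊x ^ ((1 : ℝ) / k)⌋₊).filter Nat.Prime,
        Real.log p * (p : ℝ) ^ (-(1 / 2 * (k : ℝ)))) := by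
        rw [neg_le_neg_iff, mul_comm]
        exact mul_le_mul_of_nonneg_right hbound hlx
    _ = ∑ k ∈ Icc 3 N, ∑ p ∈ (Ioc 0 ⌊x ^ ((1 : ℝ) / k)⌋₊).filter Nat.Prime,
        -(Real.log x * (Real.log p * (p : ℝ) ^ (-(1 / 2 * (k : ℝ))))) := by
        rw [Finset.mul_sum, ← Finset.sum_neg_distrib]
        refine Finset.sum_congr rfl fun k _ ↦ ?_
        rw [Finset.mul_sum, ← Finset.sum_neg_distrib]
    _ ≤ _ := Finset.sum_le_sum fun k hk ↦ Finset.sum_le_sum fun p hp ↦ hterm k hk p hp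


/-! ## §5 Assembly: GRH ⟹ (1.18) -/

/-- `χ₄(n)` as a complex number is the integer `χ₄(n)`. [folklore] -/
private theorem χ4_apply (n : ℕ) :
    (ZMod.χ₄.ringHomComp (Int.castRingHom ℂ)) (n : ZMod 4) = ((ZMod.χ₄ (n : ZMod 4) : ℤ) : ℂ) := by
  rw [MulChar.ringHomComp_apply]
  simp

/-- The complex `f_{χ₄}(x)` of the engine file is the real sum, cast. [folklore] -/
private theorem halfLineSum_χ4_ofReal (x : ℝ) :
    HalfLineRiesz.halfLineSum (ZMod.χ₄.ringHomComp (Int.castRingHom ℂ) : DirichletCharacter ℂ 4) x =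
      ((∑ n ∈ Icc 1 ⌊x⌋₊, Λ n * (ZMod.χ₄ (n : ZMod 4) : ℝ) / Real.sqrt n * Real.log (x / n) : ℝ) : ℂ) := by
  rw [HalfLineRiesz.halfLineSum]
  push_cast
  refine Finset.sum_congr rfl fun n _ ↦ ?_
  rw [show ((n : ℕ) : ZMod 4) = (n : ZMod 4) from rfl, χ4_apply]

/-- **GRH ⟹ `f_{χ₄}(x) ≤ −(L'/L)(½, χ₄) log x + B`** (real form of the engine's bound).
[cite: Suzuki2025Chebyshev, §4.1 (4.5)] -/
theorem realSum_le_of_GRH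
    (hGRH : DirichletCharacter.RiemannHypothesis (ZMod.χ₄.ringHomComp (Int.castRingHom ℂ) : DirichletCharacter ℂ 4)) :
    ∃ B : ℝ, ∀ x : ℝ, 1 < x →
      ∑ n ∈ Icc 1 ⌊x⌋₊, Λ n * (ZMod.χ₄ (n : ZMod 4) : ℝ) / Real.sqrt n * Real.log (x / n) ≤
        -(logDeriv (DirichletCharacter.LFunction
          (ZMod.χ₄.ringHomComp (Int.castRingHom ℂ) : DirichletCharacter ℂ 4)) (1 / 2)).re * Real.log x + B := by
  set χ : DirichletCharacter ℂ 4 := ZMod.χ₄.ringHomComp (Int.castRingHom ℂ) with hχdef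
  obtain ⟨B, hB⟩ := HalfLineRiesz.exists_norm_halfLineSum_add_le_of_GRH (χ := χ)
    SuzukiChi4Riesz.χ4_isPrimitive (by norm_num) SuzukiChi4Riesz.LFunction_χ4_half_ne_zero hGRH
  refine ⟨B, fun x hx ↦ ?_⟩
  have h := (Complex.re_le_norm _).trans (hB x hx)
  rw [Complex.add_re, halfLineSum_χ4_ofReal, Complex.ofReal_re, Complex.re_ofReal_mul,
    ← logDeriv_apply] at h
  linarith

/-- The typed prime sum of (1.18) is `√x` times the prime block `k = 1`:
`Σ_{2 < p ≤ x} (−1)^{(p−1)/2} log p √(x/p) log(x/p) = √x · Σ_{p ≤ x} log p · χ₄(p) p^{-1/2} log(x/p)`.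
[cite: Suzuki2025Chebyshev, §1.2 (1.18) and §4.2 (f₁)] -/
theorem primeSum_eq_sqrt_mul (x : ℝ) (hx : 0 ≤ x) :
    ∑ p ∈ (Ioc 2 ⌊x⌋₊).filter Nat.Prime,
        (-1 : ℝ) ^ ((p - 1) / 2) * Real.log p * Real.sqrt (x / p) * Real.log (x / p) =
      Real.sqrt x * ∑ p ∈ (Ioc 0 ⌊x ^ ((1 : ℝ) / (1 : ℕ))⌋₊).filter Nat.Prime,
        Real.log p * ((ZMod.χ₄ ((p ^ 1 : ℕ) : ZMod 4) : ℝ) / Real.sqrt ((p ^ 1 : ℕ) : ℝ) *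
          Real.log (x / ((p ^ 1 : ℕ) : ℝ))) := by
  have hx1 : x ^ ((1 : ℝ) / (1 : ℕ)) = x := by simp
  rw [hx1, Finset.mul_sum]
  simp only [pow_one]
  have hsub : (Ioc 2 ⌊x⌋₊).filter Nat.Prime ⊆ (Ioc 0 ⌊x⌋₊).filter Nat.Prime := by
    intro p hp
    simp only [Finset.mem_filter, Finset.mem_Ioc] at hp ⊢
    exact ⟨⟨by omega, hp.1.2⟩, hp.2⟩
  rw [← Finset.sum_subset hsub]
  · refine Finset.sum_congr rfl fun p hp ↦ ?_
    rw [Finset.mem_filter, Finset.mem_Ioc] at hp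
    have hodd : p % 2 = 1 := by
      rcases hp.2.eq_two_or_odd' with h2 | ho
      · omega
      · exact Nat.odd_iff.1 ho
    have hp0 : (0 : ℝ) ≤ p := Nat.cast_nonneg p
    rw [ZMod.χ₄_eq_neg_one_pow hodd, show (p - 1) / 2 = p / 2 by omega, Real.sqrt_div hx]
    push_cast
    ring
  · intro p hp hp'
    rw [Finset.mem_filter, Finset.mem_Ioc] at hp
    have hp2 : p = 2 := by
      by_contra hne
      have h2 := hp.2.two_le
      exact hp' (Finset.mem_filter.2 ⟨Finset.mem_Ioc.2 ⟨by omega, hp.1.2⟩, hp.2⟩)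
    subst hp2
    have h0 : ZMod.χ₄ ((2 : ℕ) : ZMod 4) = 0 := by decide
    rw [h0]
    simp

/-- `−⅛ L² + α L + β ≤ M` for `L ≥ 8(|α| + 1) + |β| + |M|`. [folklore] -/
private theorem quad_le {α β M L : ℝ} (hL : 8 * (|α| + 1) + |β| + |M| ≤ L) :
    -(1 / 8) * L ^ 2 + α * L + β ≤ M := by
  have hα := abs_nonneg α
  have hβ := abs_nonneg β
  have hM := abs_nonneg M
  have hL0 : 0 ≤ L := by linarith
  have h1 : α * L ≤ |α| * L := mul_le_mul_of_nonneg_right (le_abs_self α) hL0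
  have h2 : -(1 / 8) * L ^ 2 + |α| * L ≤ -L := by nlinarith
  linarith [le_abs_self β, neg_abs_le β, neg_abs_le M]

/-- **Suzuki 2025, Thm 4, «only if» direction, PROVED**: the GRH for `L(s, χ₄)` implies
`Σ_{2 < p ≤ x} (−1)^{(p−1)/2} log p · √(x/p) log(x/p) → −∞` ((1.18)). Printed proof (§4.2, Thm 9 at `χ = χ₄`):
`f_{χ₄} = f₁ + f₂ + f₃` with `f_{χ₄} = O(log x)` under GRH ((4.5)), `f₂ ≍ ¼ log² x` (Mertens), `f₃ = O(log x)`,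
so `f₁ = −¼(log x)²(1 + O(1/log x))` and the sum `= √x f₁ → −∞`. Here with one-sided elementary bounds
(`f₂ ≥ ⅛ log² x − O(log x)`, `f₃ ≥ −O(log x)`), which suffice for `−∞`. GRH(χ₄)-CONDITIONAL.
[cite: Suzuki2025Chebyshev, §1.2 Thm 4 («only if») with §4.2 Thm 9, (4.8)–(4.11)] -/
theorem Suzuki2025Chebyshev_thm4_mp
    (hGRH : DirichletCharacter.RiemannHypothesis (ZMod.χ₄.ringHomComp (Int.castRingHom ℂ) : DirichletCharacter ℂ 4)) :
    Tendsto (fun x : ℝ ↦ ∑ p ∈ (Ioc 2 ⌊x⌋₊).filter Nat.Prime,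
      (-1 : ℝ) ^ ((p - 1) / 2) * Real.log p * Real.sqrt (x / p) * Real.log (x / p)) atTop atBot := by
  obtain ⟨B, hB⟩ := realSum_le_of_GRH hGRH
  obtain ⟨C₁, hC₁⟩ := sq_block_ge
  obtain ⟨C₃, hC₃⟩ := higher_block_ge
  set d : ℝ := (logDeriv (DirichletCharacter.LFunction
    (ZMod.χ₄.ringHomComp (Int.castRingHom ℂ) : DirichletCharacter ℂ 4)) (1 / 2)).re with hd
  have hd0 : 0 < d := SuzukiChi4Riesz.re_logDeriv_LFunction_χ4_half_pos
  -- abbreviation for the block terms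
  set g : ℝ → ℕ → ℝ := fun x n ↦ (ZMod.χ₄ (n : ZMod 4) : ℝ) / Real.sqrt n * Real.log (x / n) with hg
  -- the prime block is bounded above by a quadratic in `log x` with negative leading coefficient
  have hU1 : ∀ x : ℝ, 1 < x →
      ∑ p ∈ (Ioc 0 ⌊x ^ ((1 : ℝ) / (1 : ℕ))⌋₊).filter Nat.Prime, Real.log p * g x (p ^ 1) ≤
        -(1 / 8) * Real.log x ^ 2 + (1 / 2 * C₁ + C₃ - d) * Real.log x + B := by
    intro x hx
    have hx0 : 0 ≤ x := by linarith
    have hx1 : 1 ≤ x := hx.le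
    set N : ℕ := max ⌊Real.log x / Real.log 2⌋₊ 3 with hN
    have hN1 : ⌊Real.log x / Real.log 2⌋₊ ≤ N := le_max_left _ _
    have hN3 : 3 ≤ N := le_max_right _ _
    -- decomposition of `f_{χ₄}(x)`
    have hdec : ∑ n ∈ Icc 1 ⌊x⌋₊, Λ n * (ZMod.χ₄ (n : ZMod 4) : ℝ) / Real.sqrt n * Real.log (x / n) =
        ∑ k ∈ Icc 1 N, ∑ p ∈ (Ioc 0 ⌊x ^ ((1 : ℝ) / k)⌋₊).filter Nat.Prime, Real.log p * g x (p ^ k) := by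
      rw [← sum_vonMangoldt_mul_eq_sum_sum (g x) hx0 hN1]
      refine Finset.sum_congr rfl fun n _ ↦ ?_
      simp only [hg]
      ring
    have hsplit : Icc 1 N = insert 1 (insert 2 (Icc 3 N)) := by
      rw [show Icc 3 N = Ioc 2 N from rfl, Finset.Ioc_insert_left (by omega),
        show Icc 2 N = Ioc 1 N from rfl, Finset.Ioc_insert_left (by omega)]
    have hnot1 : 1 ∉ insert 2 (Icc 3 N) := by simp
    have hnot2 : 2 ∉ Icc 3 N := by simp
    have hR := hB x hx
    rw [hdec, hsplit, Finset.sum_insert hnot1, Finset.sum_insert hnot2] at hR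
    have h2 := hC₁ x hx1
    have h3 := hC₃ x N hx1
    simp only [hg] at hR ⊢
    nlinarith [h2, h3, hR]
  -- conclusion
  rw [Filter.tendsto_atBot]
  intro M
  set M' : ℝ := min M (-1) with hM'
  have hM'neg : M' < 0 := lt_of_le_of_lt (min_le_right _ _) (by norm_num)
  have hM'le : M' ≤ M := min_le_left _ _
  set α : ℝ := 1 / 2 * C₁ + C₃ - d with hα
  set L₀ : ℝ := 8 * (|α| + 1) + |B| + |M'| with hL₀
  filter_upwards [eventually_ge_atTop (max 2 (Real.exp L₀))] with x hx
  have hx2 : 2 ≤ x := le_trans (le_max_left _ _) hx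
  have hx1 : 1 < x := by linarith
  have hx0 : 0 ≤ x := by linarith
  have hL : L₀ ≤ Real.log x := by
    rw [Real.le_log_iff_exp_le (by linarith)]
    exact le_trans (le_max_right _ _) hx
  have hq : -(1 / 8) * Real.log x ^ 2 + α * Real.log x + B ≤ M' := quad_le hL
  have hU := (hU1 x hx1).trans hq
  rw [primeSum_eq_sqrt_mul x hx0]
  have hsx : 1 ≤ Real.sqrt x := by
    rw [show (1 : ℝ) = Real.sqrt 1 by simp]
    exact Real.sqrt_le_sqrt hx1.le
  -- `√x · U₁ ≤ √x · M' ≤ M' ≤ M`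
  calc Real.sqrt x * ∑ p ∈ (Ioc 0 ⌊x ^ ((1 : ℝ) / (1 : ℕ))⌋₊).filter Nat.Prime,
        Real.log p * ((ZMod.χ₄ ((p ^ 1 : ℕ) : ZMod 4) : ℝ) / Real.sqrt ((p ^ 1 : ℕ) : ℝ) *
          Real.log (x / ((p ^ 1 : ℕ) : ℝ)))
      ≤ Real.sqrt x * M' := mul_le_mul_of_nonneg_left hU (Real.sqrt_nonneg x)
    _ ≤ 1 * M' := mul_le_mul_of_nonpos_right hsx hM'neg.le
    _ ≤ M := by rw [one_mul]; exact hM'le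

end SuzukiChi4Thm4

open SuzukiChi4Thm4 in
/-- **Suzuki 2025, Theorem 4 — discharge of the named fact `Suzuki2025Chebyshev_thm4`** (GRH(χ₄)-EQUIVALENT
criterion, AS TYPED in `ChebyshevHalfLineBiasVariants.lean`): «The GRH for `L(s, χ₄)` holds if and only if
`lim_{x→∞} Σ_{2<p≤x} (−1)^{(p−1)/2} log p · √(x/p) log(x/p) = −∞` (1.18).» The «if» direction is the tree's
`Suzuki2025Chebyshev_thm4_mpr` (`ChebyshevHalfLineBiasChi4Proofs.lean`, Landau via Thm 9 first half); the «only
if» direction is `Suzuki2025Chebyshev_thm4_mp` above. An EQUIVALENCE: it fixes which limit statement IS the GRH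
for `L(s, χ₄)`; nothing here bears on the truth of RH or GRH. [cite: Suzuki2025Chebyshev, §1.2 Thm 4 (and §4.2 Thm 9)] -/
theorem Suzuki2025Chebyshev_thm4_holds : Suzuki2025Chebyshev_thm4 := by
  unfold Suzuki2025Chebyshev_thm4
  intro χ
  exact ⟨fun h ↦ Suzuki2025Chebyshev_thm4_mp h, fun h ↦ Suzuki2025Chebyshev_thm4_mpr h⟩

end Literature.NumberTheory.LFunctions

end
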